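import Mathlib

/-!
# SoloBlind — the `#`-square bookkeeping behind THEOREM B04 (P-SSP block 04)

Elementary, kernel-checkable identities used in the soloist note `work/s93/block04.md`
(HodgeConjecture solo-blind residency, session s93).  THEOREM B04 itself (the block-04
component of `F₅`-rational cycle classes on the Fermat sextic fourfold mod 5 spans the
line `[h₀] = [Γ₅(1/6)⁻³]` in `ℚ₅^×/ℚ^×`) rests on cited results (Coleman's Frobenius
constants for Fermat curves, Shioda–Katsura's inductive structure, Tate for the sextic
surface) and is NOT formalised here.  What is checked:

* `hash_1113`, `hash_111111` : the character bookkeeping of Shioda–Katsura's `#`: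
  `(1,1,4)#(1,3,2) = (1,1,1,3)` and `(1,1,1,3)#(1,1,1,3) = (1,1,1,1,1,1)` (modulus 6);
* `eps_ratio_exponent`, `eps_pow_even`, `eps_pow_fifteen`, `sixth_roots_neg_one_mod5` :
  the `ε`-exponent arithmetic of LEMMA EPS (`ε⁶ = −1`; over `ℤ₅`, `ε = ±i₅`, `ε² = −1`):
  the exponent `Σc' − Σ⟨5c'⟩ = 2(Σc' − 3(s+1))` is even, so `κ_ε(c)/κ_ε(5c) ∈ ℚ^×`,
  and `ε¹⁵ = −ε`;
* `colemanEps_values_sixths`, `frobenius_orbit_sixths` : Coleman's exponent `ε(q) = 1` at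
  `q = (5/6,5/6)` and `(5/6,1/2)`, and `5·(5/6) ≡ 1/6`, `5·(1/2) ≡ 1/2 (mod 1)`;
* `lemmaSQ_eigen`, `lemmaSQ_square` : the linear algebra of LEMMA SQ — `φz = 5z` on a
  two-dimensional `φ`-block forces `d' = c_a d/5` (and `c_a c_ā = 25`), and a rational
  nonzero self-intersection `s = 2 d d' B` then determines `d² = 5s/(2 c_a B)`;
* `hashSquare_exponents` : the exponent vector computation
  `[h₀] = [i₅]¹⁵ · ([c_{(1,1,4)}][c_{(1,3,2)}])⁻¹ = [Γ₅(1/6)]⁻³` in the coordinates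
  `(exponent of Γ₅(1/3), exponent of Γ₅(1/6), exponent of i₅ mod 2)`;
* `gauss_product_sign`, `fermat_sextic_counts_F25`, `sixth_power_fibres_F25` : the sign
  bookkeeping behind "`Fr₂₅ = +25` on every primitive class of the sextic surface":
  with `G(χ^a) = (−1)^a·5` a product over a character with `Σa ≡ 0 (mod 6)` is `+5^k`,
  and the exact point counts `#X₁(F₂₅) = 126`, `#X₂(F₂₅) = 3276` (via the 6-to-1 sixth
  power map `F₂₅^× → F₅^×`, itself checked in the explicit model `F₂₅ = F₅[t]/(t² − 2)`).
-/

set_option linter.dupNamespace false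
set_option linter.style.longLine false

namespace Summit.HodgeConjecture.HodgeConjecture.Theorems

/-! ## Shioda–Katsura `#` on characters -/

/-- Shioda–Katsura's `#` on characters written as lists of residues: drop the last entry of
each factor and concatenate (defined when the dropped entries sum to `0` mod `m`). -/
def hashChar (a b : List ℕ) : List ℕ := a.dropLast ++ b.dropLast

/-- Admissibility test of `a # b` for modulus `m`: the two dropped entries sum to `0 (mod m)`. -/
def hashAdmissible (m : ℕ) (a b : List ℕ) : Bool := (a.getLastD 0 + b.getLastD 0) % m == 0

/-- `(1,1,4) # (1,3,2) = (1,1,1,3)` for `m = 6` (the surface character from two curve characters). -/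
theorem hash_1113 : hashAdmissible 6 [1, 1, 4] [1, 3, 2] = true ∧ hashChar [1, 1, 4] [1, 3, 2] = [1, 1, 1, 3] := by
  decide

/-- `(1,1,1,3) # (1,1,1,3) = (1,1,1,1,1,1)` for `m = 6`: the holomorphic character of the sextic
fourfold is the `#`-square of the surface character `(1,1,1,3)`. -/
theorem hash_111111 :
    hashAdmissible 6 [1, 1, 1, 3] [1, 1, 1, 3] = true ∧ hashChar [1, 1, 1, 3] [1, 1, 1, 3] = [1, 1, 1, 1, 1, 1] := by
  decide

/-- All entries of both characters lie in `{1,…,5}` and each sums to `0 (mod 6)`. -/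
theorem chars_wellformed :
    ([1, 1, 4].sum % 6 = 0 ∧ [1, 3, 2].sum % 6 = 0 ∧ [1, 1, 1, 3].sum % 6 = 0 ∧ [1, 1, 1, 1, 1, 1].sum % 6 = 0) ∧
    (∀ x ∈ ([1, 1, 4] ++ [1, 3, 2] ++ [1, 1, 1, 3] : List ℕ), 1 ≤ x ∧ x ≤ 5) := by
  decide

/-! ## The `ε`-exponent arithmetic of LEMMA EPS -/

/-- For the second factor's entries `c'` (as integers) the exponent `Σ c' − Σ (6 − c')`
(`= Σc' − Σ⟨5c'⟩` for `1 ≤ c' ≤ 5`) equals `2·(Σc' − 3·(number of entries))`, hence is even. -/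
theorem eps_ratio_exponent (l : List ℤ) :
    l.sum - (l.map (fun c => 6 - c)).sum = 2 * (l.sum - 3 * (l.length : ℤ)) := by
  induction l with
  | nil => simp
  | cons x t ih =>
    simp only [List.sum_cons, List.map_cons, List.length_cons, Nat.cast_succ]
    linarith

/-- For `1 ≤ c ≤ 5`, the representative of `5c (mod 6)` in `{1,…,5}` is `6 − c`. -/
theorem five_mul_mod_six : ∀ c : ℕ, 1 ≤ c → c ≤ 5 → (5 * c) % 6 = 6 - c := by
  decide

/-- With `ε² = −1` (the square roots `±i₅` of `−1` are the only sixth roots of `−1` in `ℤ₅`),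
an even power of `ε` is `±1`, i.e. rational. -/
theorem eps_pow_even {R : Type*} [CommRing R] (ε : R) (h : ε ^ 2 = -1) (k : ℕ) :
    ε ^ (2 * k) = (-1) ^ k := by
  rw [pow_mul, h]

/-- `ε¹⁵ = −ε` when `ε² = −1` (the `#`-constant of the character `(5⁶)`: `Σc' = 15`). -/
theorem eps_pow_fifteen {R : Type*} [CommRing R] (ε : R) (h : ε ^ 2 = -1) : ε ^ 15 = -ε := by
  have : ε ^ 15 = (ε ^ 2) ^ 7 * ε := by ring
  rw [this, h]; ring

/-- In the residue field `F₅` the sixth roots of `−1` are exactly `±2 = ±i₅ (mod 5)`, and `2² = −1`. -/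
theorem sixth_roots_neg_one_mod5 :
    (∀ x : ZMod 5, x ^ 6 = -1 ↔ (x = 2 ∨ x = 3)) ∧ (2 : ZMod 5) ^ 2 = -1 ∧ (3 : ZMod 5) = -2 := by
  decide

/-! ## Coleman's exponent at the order-6 arguments -/

/-- `⟨5/6 + 1/2⟩ = 1/3`. -/
theorem fract_5_6_add_1_2 : Int.fract ((5 : ℚ) / 6 + 1 / 2) = 1 / 3 :=
  Int.fract_eq_iff.mpr ⟨by norm_num, by norm_num, 1, by norm_num⟩
/-- `⟨5/6 + 5/6⟩ = 2/3`. -/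
theorem fract_5_6_add_5_6 : Int.fract ((5 : ℚ) / 6 + 5 / 6) = 2 / 3 :=
  Int.fract_eq_iff.mpr ⟨by norm_num, by norm_num, 1, by norm_num⟩
/-- `fract(5/6) = 5/6`. -/
theorem fract_5_6 : Int.fract ((5 : ℚ) / 6) = 5 / 6 :=
  Int.fract_eq_iff.mpr ⟨by norm_num, by norm_num, 0, by norm_num⟩
/-- `fract(1/2) = 1/2`. -/
theorem fract_1_2 : Int.fract ((1 : ℚ) / 2) = 1 / 2 :=
  Int.fract_eq_iff.mpr ⟨by norm_num, by norm_num, 0, by norm_num⟩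
/-- `fract(25/6) = 1/6` (`5·(5/6) ≡ 1/6 (mod 1)`). -/
theorem fract_25_6 : Int.fract ((25 : ℚ) / 6) = 1 / 6 :=
  Int.fract_eq_iff.mpr ⟨by norm_num, by norm_num, 4, by norm_num⟩
/-- `fract(5/2) = 1/2` (`5·(1/2) ≡ 1/2 (mod 1)`). -/
theorem fract_5_2 : Int.fract ((5 : ℚ) / 2) = 1 / 2 :=
  Int.fract_eq_iff.mpr ⟨by norm_num, by norm_num, 2, by norm_num⟩

/-- Coleman's exponent `ε(r,s) = ⟨r⟩ + ⟨s⟩ − ⟨r+s⟩` at the two order-6 arguments used in THEOREM B04: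
`ε(5/6,5/6) = 1` and `ε(5/6,1/2) = 1` (written out; these are `colemanEps (5/6) (5/6)` and
`colemanEps (5/6) (1/2)` of `SoloBlindFrobeniusJoin` by `rfl`). -/
theorem colemanEps_values_sixths :
    Int.fract ((5 : ℚ) / 6) + Int.fract ((5 : ℚ) / 6) - Int.fract ((5 : ℚ) / 6 + 5 / 6) = 1 ∧
    Int.fract ((5 : ℚ) / 6) + Int.fract ((1 : ℚ) / 2) - Int.fract ((5 : ℚ) / 6 + 1 / 2) = 1 := by
  rw [fract_5_6, fract_1_2, fract_5_6_add_5_6, fract_5_6_add_1_2]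
  norm_num

/-- Frobenius-orbit bookkeeping mod 1 at `p = 5` for the order-6 arguments: `5·(5/6) ≡ 1/6` and
`5·(1/2) ≡ 1/2`. -/
theorem frobenius_orbit_sixths :
    Int.fract (5 * ((5 : ℚ) / 6)) = 1 / 6 ∧ Int.fract (5 * ((1 : ℚ) / 2)) = 1 / 2 := by
  rw [show 5 * ((5 : ℚ) / 6) = 25 / 6 by norm_num, show 5 * ((1 : ℚ) / 2) = 5 / 2 by norm_num,
    fract_25_6, fract_5_2]
  exact ⟨rfl, rfl⟩

/-! ## LEMMA SQ: the two-dimensional `φ`-block -/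

/-- On a block with `φ e_a = c_a e_ā`, `φ e_ā = c_ā e_a`, the class `z = d e_a + d' e_ā` satisfies
`φ z = 5 z` iff `d c_a = 5 d'` and `d' c_ā = 5 d` (coordinates); then `d' = c_a d / 5`, and if
`d ≠ 0` also `c_a c_ā = 25`. -/
theorem lemmaSQ_eigen {K : Type*} [Field K] [CharZero K] (ca cb d d' : K)
    (h1 : d * ca = 5 * d') (h2 : d' * cb = 5 * d) :
    d' = ca * d / 5 ∧ (d ≠ 0 → ca * cb = 25) := by
  have h5 : (5 : K) ≠ 0 := by norm_num
  refine ⟨?_, ?_⟩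
  · rw [eq_div_iff h5]
    linear_combination -h1
  · intro hd
    have h : d * (ca * cb - 25) = 0 := by linear_combination cb * h1 + 5 * h2
    rcases mul_eq_zero.mp h with h | h
    · exact absurd h hd
    · exact sub_eq_zero.mp h

/-- If moreover the self-intersection `s = 2 d d' B` (with `B = ⟨e_a, e_ā⟩ ≠ 0`, `c_a ≠ 0`) is
known, then `d² = 5 s / (2 c_a B)`: the SQUARE of the coordinate is determined (by a rational
number, when `s ∈ ℚ^×`), with no square-root ambiguity. -/
theorem lemmaSQ_square {K : Type*} [Field K] [CharZero K] (ca B d d' s : K)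
    (hca : ca ≠ 0) (hB : B ≠ 0) (hd' : d' = ca * d / 5) (hs : s = 2 * d * d' * B) :
    d ^ 2 = 5 * s / (2 * ca * B) := by
  subst hd' hs
  field_simp

/-! ## The exponent computation `[h₀] = [Γ₅(1/6)⁻³]` -/

/-- Classes in `ℚ₅^×/ℚ^×` of `Γ₅`-monomials, in the coordinates
`(exponent of Γ₅(1/3), exponent of Γ₅(1/6), exponent of i₅ mod 2)` (additively; `i₅² = −1 ∈ ℚ^×`,
`Γ₅(2/3) ∈ ±Γ₅(1/3)⁻¹`, `Γ₅(5/6) ∈ ±Γ₅(1/6)⁻¹`, `Γ₅(1/2) ∈ ±i₅` by Gross–Koblitz reflection):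
`[c_{(1,1,4)}] = [Γ₅(2/3)Γ₅(5/6)⁻²] = (−1, 2, 0)`, `[c_{(1,3,2)}] = [Γ₅(1/3)Γ₅(5/6)⁻¹Γ₅(1/2)⁻¹] = (1, 1, 1)`;
their sum `[c_{(1,1,1,3)}] = (0, 3, 1) = [i₅Γ₅(1/6)³]`, twice that is `[c₀] = (0, 6, 0) = [Γ₅(1/6)⁶]`,
and `[h₀] = 15·[i₅] − [c_{(1,1,1,3)}] = (0, −3, 0) = [Γ₅(1/6)⁻³]`. -/
theorem hashSquare_exponents :
    ((-1 : ℤ), (2 : ℤ), (0 : ZMod 2)) + (1, 1, 1) = (0, 3, 1) ∧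
    (2 : ℕ) • ((0 : ℤ), (3 : ℤ), (1 : ZMod 2)) = (0, 6, 0) ∧
    (15 : ℕ) • ((0 : ℤ), (0 : ℤ), (1 : ZMod 2)) - (0, 3, 1) = (0, -3, 0) := by
  decide

/-! ## Signs: Gauss products and the point counts over `F₂₅` -/

/-- With `G(χ^a) = (−1)^a · 5` (the pure Gauss sums over `F₂₅` of the order-6 character), the product
over a character is `(−1)^{Σa} · 5^k`. -/
theorem gauss_product_formula (l : List ℕ) :
    (l.map (fun a => (-1 : ℤ) ^ a * 5)).prod = (-1) ^ l.sum * 5 ^ l.length := by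
  induction l with
  | nil => simp
  | cons x t ih =>
    simp only [List.map_cons, List.prod_cons, List.sum_cons, List.length_cons, ih, pow_add, pow_succ]
    ring

/-- Hence for a character with `Σ a ≡ 0 (mod 6)` the product is `+5^k`: on the sextic SURFACE
(`k = 4`, sign `(−1)^n = +1`, `q = 25`) every primitive eigenvalue of `Fr₂₅` is `+625/25 = +25`, and on
the curve (`k = 3`, `n = 1`) every eigenvalue is `−125/25 = −5`. -/
theorem gauss_product_sign (l : List ℕ) (h : l.sum % 6 = 0) :
    (l.map (fun a => (-1 : ℤ) ^ a * 5)).prod = 5 ^ l.length := by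
  rw [gauss_product_formula]
  have he : Even l.sum := Nat.even_iff.mpr (by omega)
  rw [he.neg_one_pow, one_mul]

/-- The eigenvalue arithmetic: `(−1)^2 · 5^4 / 25 = 25` (surface) and `(−1)^1 · 5^3 / 25 = −5` (curve). -/
theorem frob25_eigenvalues : ((-1 : ℚ) ^ 2 * 5 ^ 4 / 25 = 25) ∧ ((-1 : ℚ) ^ 1 * 5 ^ 3 / 25 = -5) := by
  norm_num

/-- Multiplication in the explicit model `F₂₅ = F₅[t]/(t² − 2)`, elements as pairs `(a, b) = a + b t`. -/
def mulF25 (x y : ZMod 5 × ZMod 5) : ZMod 5 × ZMod 5 :=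
  (x.1 * y.1 + 2 * x.2 * y.2, x.1 * y.2 + x.2 * y.1)

/-- Sixth power in the model of `F₂₅`. -/
def pow6F25 (x : ZMod 5 × ZMod 5) : ZMod 5 × ZMod 5 :=
  let x2 := mulF25 x x
  let x3 := mulF25 x2 x
  mulF25 x3 x3

/-- `2` is a non-square mod 5 (so `F₅[t]/(t² − 2)` is the field `F₂₅`), and the sixth-power map sends
`F₂₅` into `F₅` with fibres of size `6` over each nonzero `u ∈ F₅` and `{0}` over `0`. -/
theorem sixth_power_fibres_F25 :
    (∀ y : ZMod 5, y ^ 2 ≠ 2) ∧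
    (∀ x : ZMod 5 × ZMod 5, (pow6F25 x).2 = 0) ∧
    (∀ u : ZMod 5, u ≠ 0 → (Finset.univ.filter (fun x : ZMod 5 × ZMod 5 => pow6F25 x = (u, 0))).card = 6) ∧
    (Finset.univ.filter (fun x : ZMod 5 × ZMod 5 => pow6F25 x = (0, 0))).card = 1 := by
  refine ⟨by decide, by decide, by decide, by decide⟩

/-- Weight of a value `u ∈ F₅` of the sixth-power map: number of `x ∈ F₂₅` with `x⁶ = u`. -/
def w6 (u : ZMod 5) : ℕ := if u = 0 then 1 else 6

set_option maxRecDepth 100000 in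
/-- Exact point counts over `F₂₅` of the Fermat sextic curve and surface, through the sixth-power map:
the affine cone counts (solutions of `u₀ + ⋯ + u_k = 0` in `F₅`, weighted) are `Σ w6(u₀)w6(u₁)w6(−u₀−u₁) = 3025` and `Σ w6(u₀)w6(u₁)w6(u₂)w6(−u₀−u₁−u₂) = 78625`,
so `#X₁(F₂₅) = (3025 − 1)/24 = 126` (the Hermitian curve: maximal) and `#X₂(F₂₅) = (78625 − 1)/24 = 3276`
(`= 1 + 25 + 625 + 105·25`: all 105 primitive eigenvalues are `+25`, Picard number 106). -/
theorem fermat_sextic_counts_F25 :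
    (∑ a : ZMod 5, ∑ b : ZMod 5, w6 a * w6 b * w6 (-a - b)) = 3025 ∧
    (∑ a : ZMod 5, ∑ b : ZMod 5, ∑ c : ZMod 5, w6 a * w6 b * w6 c * w6 (-a - b - c)) = 78625 ∧
    (3025 - 1) / 24 = 126 ∧ (78625 - 1) / 24 = 3276 ∧
    126 = 1 + 25 + 20 * 5 ∧ 3276 = 1 + 25 + 625 + 105 * 25 := by
  refine ⟨by decide, by decide, by norm_num, by norm_num, by norm_num, by norm_num⟩

end Summit.HodgeConjecture.HodgeConjecture.Theorems
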